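import Summits.Ventures.DiscreteObjects.Hadamard.Order4Nega

/-!
# H(668): involutions and order-4 automorphisms — one quotable kernel statement (gen 13 summary)

Framing: lottery ticket; floor = certified bounds/negative ranges.

Cell pub-namedobj (venture DiscreteObjects), target (H), hadamard gen 13.  Packaging (nothing new is proved here) of the two
gen-13 headline theorems about a signed-permutation automorphism `(π, κ, d, e)` of a Hadamard matrix of order `668`, for
STATEMENT.md:
* (involutions, `hadamard668_involution_census_final`) if `π² = κ² = 1` and `(π, κ) ≠ (1, 1)` then EITHER type I — `#Fix π = #Fix κ = f`
  with `f ≡ 4 (mod 8)`, `4 ≤ f ≤ 332`, one common sign on all fixed rows and columns — OR nega fixed-point-free — no fixed row or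
  column, `d (π i) = −d i`, `e (κ j) = −e j`;
* (order 4, `no_hadamard668_aut_order4_sq_fpf`) if `π⁴ = κ⁴ = 1` then `π²` has a fixed row or `κ²` has a fixed column — the square of
  an order-4 automorphism is never fixed-point-free (hence, by the first part, it is trivial or a type-I involution).
`hadamard668_involution_order4_summary`.  Ours; no `sorry`.
-/

namespace Summit.Ventures.DiscreteObjects.Hadamard

open Finset BigOperators Matrix

open Literature.Combinatorics.Designs.GoethalsSeidel (IsHadamardMatrix)

variable {ι : Type*} [Fintype ι] [DecidableEq ι]

/-- **H(668) — INVOLUTIONS AND ORDER-4 AUTOMORPHISMS (gen 13 summary).**  See the module docstring. -/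
theorem hadamard668_involution_order4_summary {H : Matrix ι ι ℤ} (hH : IsHadamardMatrix H)
    (hι : Fintype.card ι = 668) (π κ : Equiv.Perm ι) (d e : ι → ℤ) (haut : IsSignedAut H π κ d e) :
    ((π ^ 2 = 1 ∧ κ ^ 2 = 1 ∧ (π ≠ 1 ∨ κ ≠ 1)) →
      π ≠ 1 ∧ κ ≠ 1 ∧
      (((univ.filter fun i => π i = i).card = (univ.filter fun j => κ j = j).card ∧
          (univ.filter fun i => π i = i).card % 8 = 4 ∧ 4 ≤ (univ.filter fun i => π i = i).card ∧
          (univ.filter fun i => π i = i).card ≤ 332 ∧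
          ∃ δ : ℤ, (δ = 1 ∨ δ = -1) ∧ (∀ i, π i = i → d i = δ) ∧ (∀ j, κ j = j → e j = δ)) ∨
       ((univ.filter fun i => π i = i).card = 0 ∧ (univ.filter fun j => κ j = j).card = 0 ∧
          (∀ i, d (π i) = -d i) ∧ (∀ j, e (κ j) = -e j)))) ∧
    ((∀ i, π (π (π (π i))) = i) → (∀ j, κ (κ (κ (κ j))) = j) →
      (∃ i, π (π i) = i) ∨ (∃ j, κ (κ j) = j)) := by
  refine ⟨fun ⟨hπ, hκ, hne⟩ => hadamard668_involution_census_final hH hι π κ d e haut hπ hκ hne, fun hπ4 hκ4 => ?_⟩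
  by_contra h
  push Not at h
  exact no_hadamard668_aut_order4_sq_fpf hH hι haut hπ4 hκ4 h.1 h.2

end Summit.Ventures.DiscreteObjects.Hadamard
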